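import Literature.Computability.AlgebraicComplexity.DGIJLLiftingStruct41
import Literature.Computability.AlgebraicComplexity.DGIJLLiftingStruct32
import Literature.Computability.AlgebraicComplexity.DGIJLLiftingStruct311
import Literature.Computability.AlgebraicComplexity.DGIJLLiftingStruct221
import Literature.Computability.AlgebraicComplexity.DGIJLLiftingStruct2111
import Literature.Computability.AlgebraicComplexity.DGIJLLiftingPoints
import Literature.Computability.AlgebraicComplexity.DGIJLLiftingSums
import HarnessLib

/-!
# DGIJL Prop. 4.12 by explicit tableaux, VIII: the ν-part sums at the evaluation points

Topic `Literature/Computability/AlgebraicComplexity`; proofs + one plumbing def (no named facts).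
For each of the five fillings `T` the closed form `T.aeval_eq` (files IV) ends in the sum
`Σ_(v injective) nuf_T(A, v)`; at a point `A = pt a₀ a₁ a₂ a₃` (file VI) the factor `nuf_T` is a
difference of two products of one-coordinate functions (`tallMinor_pt`), so the sum is evaluated by
the inclusion–exclusion identities of file VII in terms of the power sums
`prs e = Σ_x ptRow(x)^e = a₀^e + a₁^e + a₂^e + a₃^e` (`prs_eq`) and the value `a₁` at `xE 1`.
Certificate for

* Dutta–Gesmundo–Ikenmeyer–Jindal–Lysikov, arXiv:2211.07055, **Prop. 4.12**;

design note `run/shared/lean/pub/val-lit/bip/DGIJL-Prop412-DESIGN-p6.md`. Honest framing: explicit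
evaluation of a kernel certificate; nothing here bears on VP versus VNP.
-/

noncomputable section

open scoped BigOperators

namespace Literature.Computability.AlgebraicComplexity

namespace DGIJLLift

open TableauEval

variable (k : ℕ)

/-- The power sums of the prescribed row: `prs e = Σ_x ptRow(x) ^ e`.
[cite: DuttaGesmundoIkenmeyerJindalLysikovJSC2025, Prop. 4.12] -/
def prs (a₀ a₁ a₂ a₃ : ℂ) (e : ℕ) : ℂ := ∑ x : Fin (2 * k + 5), ptRow k a₀ a₁ a₂ a₃ x ^ e

variable {k}

/-- Unfolding `prs`. [cite: DuttaGesmundoIkenmeyerJindalLysikovJSC2025, Prop. 4.12] -/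
theorem prs_def (a₀ a₁ a₂ a₃ : ℂ) (e : ℕ) :
    prs k a₀ a₁ a₂ a₃ e = ∑ x : Fin (2 * k + 5), ptRow k a₀ a₁ a₂ a₃ x ^ e := rfl

/-- **The power sums in closed form**: `prs e = a₀^e + a₁^e + a₂^e + a₃^e` for `e ≥ 1`.
[cite: DuttaGesmundoIkenmeyerJindalLysikovJSC2025, Prop. 4.12] -/
theorem prs_eq (a₀ a₁ a₂ a₃ : ℂ) {e : ℕ} (he : 1 ≤ e) :
    prs k a₀ a₁ a₂ a₃ e = a₀ ^ e + a₁ ^ e + a₂ ^ e + a₃ ^ e := by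
  unfold prs
  have h01 : xE k 0 ≠ xE k 1 := xE_ne (by omega) (by omega) (by omega)
  have h02 : xE k 0 ≠ xE k 2 := xE_ne (by omega) (by omega) (by omega)
  have h03 : xE k 0 ≠ xE k 3 := xE_ne (by omega) (by omega) (by omega)
  have h12 : xE k 1 ≠ xE k 2 := xE_ne (by omega) (by omega) (by omega)
  have h13 : xE k 1 ≠ xE k 3 := xE_ne (by omega) (by omega) (by omega)
  have h23 : xE k 2 ≠ xE k 3 := xE_ne (by omega) (by omega) (by omega)
  rw [← Finset.sum_subset (Finset.subset_univ ({xE k 0, xE k 1, xE k 2, xE k 3} : Finset _))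
    (fun x _ hx => by
      rw [Finset.mem_insert, Finset.mem_insert, Finset.mem_insert, Finset.mem_singleton] at hx
      simp only [not_or] at hx
      rw [ptRow_eq_zero a₀ a₁ a₂ a₃ hx.1 hx.2.1 hx.2.2.1 hx.2.2.2, zero_pow (by omega)])]
  rw [Finset.sum_insert (by simp [h01, h02, h03]), Finset.sum_insert (by simp [h12, h13]),
    Finset.sum_pair h23]
  obtain ⟨e0, e1, e2, e3⟩ := ptRow_xE (k := k) a₀ a₁ a₂ a₃
  rw [e0, e1, e2, e3]
  ring

/-- A sum against the indicator of `xE 1` is an evaluation.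
[cite: DuttaGesmundoIkenmeyerJindalLysikovJSC2025, Prop. 4.12] -/
theorem sum_ite_xE_one (g : Fin (2 * k + 5) → ℂ) :
    (∑ x : Fin (2 * k + 5), if x = xE k 1 then g x else 0) = g (xE k 1) := by
  rw [Finset.sum_ite_eq' Finset.univ (xE k 1) g, if_pos (Finset.mem_univ _)]

section Shapes

variable (a₀ a₁ a₂ a₃ : ℂ)

/-- The `2 × 2` minor at a point, split along the indicator of `xE 1` and multiplied into the
singleton powers: the pointwise identity behind all evaluations (classes `A`, `B` at values `x`, `y`).
[cite: DuttaGesmundoIkenmeyerJindalLysikovJSC2025, Prop. 4.12] -/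
theorem tallMinor_pt_mul_pow (x y : Fin (2 * k + 5)) (hxy : x ≠ y) (e f : ℕ) (R : ℂ) :
    tallMinor k (pt k a₀ a₁ a₂ a₃) x y *
        (ptRow k a₀ a₁ a₂ a₃ x ^ e * ptRow k a₀ a₁ a₂ a₃ y ^ f * R) =
      ptRow k a₀ a₁ a₂ a₃ x ^ (e + 1) * (if y = xE k 1 then a₁ ^ f else 0) * R -
        (if x = xE k 1 then a₁ ^ e else 0) * ptRow k a₀ a₁ a₂ a₃ y ^ (f + 1) * R := by
  have e1 := (ptRow_xE (k := k) a₀ a₁ a₂ a₃).2.1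
  rw [tallMinor_pt]
  by_cases hx : x = xE k 1
  · have hy : y ≠ xE k 1 := fun h => hxy (hx.trans h.symm)
    rw [if_pos hx, if_neg hy, if_pos hx, if_neg hy, hx, e1]
    ring
  · by_cases hy : y = xE k 1
    · rw [if_neg hx, if_pos hy, if_neg hx, if_pos hy, hy, e1]
      ring
    · rw [if_neg hx, if_neg hy, if_neg hx, if_neg hy]
      ring

/-- **Two classes** (`T41`, `T32`): `Σ_(v inj) M(v0,v1) a(v0)^e a(v1)^f = prs(e+1) a₁^f - a₁^e prs(f+1)`.
[cite: DuttaGesmundoIkenmeyerJindalLysikovJSC2025, Prop. 4.12] -/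
theorem sum_nuf2 (e f : ℕ) :
    (∑ v : Fin 2 → Fin (2 * k + 5), if Function.Injective v then
        tallMinor k (pt k a₀ a₁ a₂ a₃) (v 0) (v 1) *
          ((pt k a₀ a₁ a₂ a₃) (xE k 0) (v 0) ^ e * (pt k a₀ a₁ a₂ a₃) (xE k 0) (v 1) ^ f) else 0) =
      prs k a₀ a₁ a₂ a₃ (e + 1) * a₁ ^ f - a₁ ^ e * prs k a₀ a₁ a₂ a₃ (f + 1) := by
  have e1 := (ptRow_xE (k := k) a₀ a₁ a₂ a₃).2.1
  have hsplit : ∀ v : Fin 2 → Fin (2 * k + 5),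
      (if Function.Injective v then tallMinor k (pt k a₀ a₁ a₂ a₃) (v 0) (v 1) *
          ((pt k a₀ a₁ a₂ a₃) (xE k 0) (v 0) ^ e * (pt k a₀ a₁ a₂ a₃) (xE k 0) (v 1) ^ f) else 0) =
        (if Function.Injective v then
          (fun x => ptRow k a₀ a₁ a₂ a₃ x ^ (e + 1)) (v 0) *
            (fun y => if y = xE k 1 then a₁ ^ f else 0) (v 1) else 0) -
        (if Function.Injective v then
          (fun x => if x = xE k 1 then a₁ ^ e else 0) (v 0) *
            (fun y => ptRow k a₀ a₁ a₂ a₃ y ^ (f + 1)) (v 1) else 0) := by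
    intro v
    split_ifs with hv
    · have h01 : v 0 ≠ v 1 := fun h => absurd (hv h) (by decide)
      rw [pt_apply_top, pt_apply_top, ← mul_one (_ ^ e * _ ^ f),
        tallMinor_pt_mul_pow a₀ a₁ a₂ a₃ (v 0) (v 1) h01 e f 1]
      ring
    · simp
  rw [Finset.sum_congr rfl fun v _ => hsplit v, Finset.sum_sub_distrib,
    sum_inj_two (fun x => ptRow k a₀ a₁ a₂ a₃ x ^ (e + 1)) (fun y => if y = xE k 1 then a₁ ^ f else 0),
    sum_inj_two (fun x => if x = xE k 1 then a₁ ^ e else 0) (fun y => ptRow k a₀ a₁ a₂ a₃ y ^ (f + 1))]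
  simp only [mul_ite, ite_mul, mul_zero, zero_mul, sum_ite_xE_one, e1, ← prs_def]
  ring

/-- **Three classes, minor on classes `0, 1`** (`T311`), by `sum_inj_three`.
[cite: DuttaGesmundoIkenmeyerJindalLysikovJSC2025, Prop. 4.12] -/
theorem sum_nuf3_01 (e f g : ℕ) :
    (∑ v : Fin 3 → Fin (2 * k + 5), if Function.Injective v then
        tallMinor k (pt k a₀ a₁ a₂ a₃) (v 0) (v 1) *
          ((pt k a₀ a₁ a₂ a₃) (xE k 0) (v 0) ^ e * (pt k a₀ a₁ a₂ a₃) (xE k 0) (v 1) ^ f *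
            (pt k a₀ a₁ a₂ a₃) (xE k 0) (v 2) ^ g) else 0) =
      (prs k a₀ a₁ a₂ a₃ (e + 1) * a₁ ^ f * prs k a₀ a₁ a₂ a₃ g
          - a₁ ^ (e + 1) * a₁ ^ f * prs k a₀ a₁ a₂ a₃ g
          - prs k a₀ a₁ a₂ a₃ (e + 1 + g) * a₁ ^ f
          - a₁ ^ f * a₁ ^ g * prs k a₀ a₁ a₂ a₃ (e + 1)
          + 2 * (a₁ ^ (e + 1) * a₁ ^ f * a₁ ^ g))
      - (a₁ ^ e * prs k a₀ a₁ a₂ a₃ (f + 1) * prs k a₀ a₁ a₂ a₃ g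
          - a₁ ^ e * a₁ ^ (f + 1) * prs k a₀ a₁ a₂ a₃ g
          - a₁ ^ e * a₁ ^ g * prs k a₀ a₁ a₂ a₃ (f + 1)
          - prs k a₀ a₁ a₂ a₃ (f + 1 + g) * a₁ ^ e
          + 2 * (a₁ ^ e * a₁ ^ (f + 1) * a₁ ^ g)) := by
  have e1 := (ptRow_xE (k := k) a₀ a₁ a₂ a₃).2.1
  have hsplit : ∀ v : Fin 3 → Fin (2 * k + 5),
      (if Function.Injective v then tallMinor k (pt k a₀ a₁ a₂ a₃) (v 0) (v 1) *
          ((pt k a₀ a₁ a₂ a₃) (xE k 0) (v 0) ^ e * (pt k a₀ a₁ a₂ a₃) (xE k 0) (v 1) ^ f *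
            (pt k a₀ a₁ a₂ a₃) (xE k 0) (v 2) ^ g) else 0) =
        (if Function.Injective v then
          (fun x => ptRow k a₀ a₁ a₂ a₃ x ^ (e + 1)) (v 0) *
            (fun y => if y = xE k 1 then a₁ ^ f else 0) (v 1) *
            (fun z => ptRow k a₀ a₁ a₂ a₃ z ^ g) (v 2) else 0) -
        (if Function.Injective v then
          (fun x => if x = xE k 1 then a₁ ^ e else 0) (v 0) *
            (fun y => ptRow k a₀ a₁ a₂ a₃ y ^ (f + 1)) (v 1) *
            (fun z => ptRow k a₀ a₁ a₂ a₃ z ^ g) (v 2) else 0) := by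
    intro v
    split_ifs with hv
    · have h01 : v 0 ≠ v 1 := fun h => absurd (hv h) (by decide)
      rw [pt_apply_top, pt_apply_top, pt_apply_top,
        tallMinor_pt_mul_pow a₀ a₁ a₂ a₃ (v 0) (v 1) h01 e f _]
    · simp
  rw [Finset.sum_congr rfl fun v _ => hsplit v, Finset.sum_sub_distrib,
    sum_inj_three (fun x => ptRow k a₀ a₁ a₂ a₃ x ^ (e + 1)) (fun y => if y = xE k 1 then a₁ ^ f else 0)
      (fun z => ptRow k a₀ a₁ a₂ a₃ z ^ g),
    sum_inj_three (fun x => if x = xE k 1 then a₁ ^ e else 0) (fun y => ptRow k a₀ a₁ a₂ a₃ y ^ (f + 1))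
      (fun z => ptRow k a₀ a₁ a₂ a₃ z ^ g)]
  simp only [mul_ite, ite_mul, mul_zero, zero_mul, sum_ite_xE_one, e1, ← pow_add, ← prs_def]

/-- **Three classes, minor on classes `0, 2`** (`T221`), by `sum_inj_three`.
[cite: DuttaGesmundoIkenmeyerJindalLysikovJSC2025, Prop. 4.12] -/
theorem sum_nuf3_02 (e f g : ℕ) :
    (∑ v : Fin 3 → Fin (2 * k + 5), if Function.Injective v then
        tallMinor k (pt k a₀ a₁ a₂ a₃) (v 0) (v 2) *
          ((pt k a₀ a₁ a₂ a₃) (xE k 0) (v 0) ^ e * (pt k a₀ a₁ a₂ a₃) (xE k 0) (v 1) ^ f *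
            (pt k a₀ a₁ a₂ a₃) (xE k 0) (v 2) ^ g) else 0) =
      (prs k a₀ a₁ a₂ a₃ (e + 1) * prs k a₀ a₁ a₂ a₃ f * a₁ ^ g
          - prs k a₀ a₁ a₂ a₃ (e + 1 + f) * a₁ ^ g
          - a₁ ^ (e + 1) * a₁ ^ g * prs k a₀ a₁ a₂ a₃ f
          - a₁ ^ f * a₁ ^ g * prs k a₀ a₁ a₂ a₃ (e + 1)
          + 2 * (a₁ ^ (e + 1) * a₁ ^ f * a₁ ^ g))
      - (a₁ ^ e * prs k a₀ a₁ a₂ a₃ f * prs k a₀ a₁ a₂ a₃ (g + 1)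
          - a₁ ^ e * a₁ ^ f * prs k a₀ a₁ a₂ a₃ (g + 1)
          - a₁ ^ e * a₁ ^ (g + 1) * prs k a₀ a₁ a₂ a₃ f
          - prs k a₀ a₁ a₂ a₃ (f + (g + 1)) * a₁ ^ e
          + 2 * (a₁ ^ e * a₁ ^ f * a₁ ^ (g + 1))) := by
  have e1 := (ptRow_xE (k := k) a₀ a₁ a₂ a₃).2.1
  have hsplit : ∀ v : Fin 3 → Fin (2 * k + 5),
      (if Function.Injective v then tallMinor k (pt k a₀ a₁ a₂ a₃) (v 0) (v 2) *
          ((pt k a₀ a₁ a₂ a₃) (xE k 0) (v 0) ^ e * (pt k a₀ a₁ a₂ a₃) (xE k 0) (v 1) ^ f *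
            (pt k a₀ a₁ a₂ a₃) (xE k 0) (v 2) ^ g) else 0) =
        (if Function.Injective v then
          (fun x => ptRow k a₀ a₁ a₂ a₃ x ^ (e + 1)) (v 0) *
            (fun y => ptRow k a₀ a₁ a₂ a₃ y ^ f) (v 1) *
            (fun z => if z = xE k 1 then a₁ ^ g else 0) (v 2) else 0) -
        (if Function.Injective v then
          (fun x => if x = xE k 1 then a₁ ^ e else 0) (v 0) *
            (fun y => ptRow k a₀ a₁ a₂ a₃ y ^ f) (v 1) *
            (fun z => ptRow k a₀ a₁ a₂ a₃ z ^ (g + 1)) (v 2) else 0) := by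
    intro v
    split_ifs with hv
    · have h02 : v 0 ≠ v 2 := fun h => absurd (hv h) (by decide)
      rw [pt_apply_top, pt_apply_top, pt_apply_top,
        show ptRow k a₀ a₁ a₂ a₃ (v 0) ^ e * ptRow k a₀ a₁ a₂ a₃ (v 1) ^ f * ptRow k a₀ a₁ a₂ a₃ (v 2) ^ g
          = ptRow k a₀ a₁ a₂ a₃ (v 0) ^ e * ptRow k a₀ a₁ a₂ a₃ (v 2) ^ g * ptRow k a₀ a₁ a₂ a₃ (v 1) ^ f
          from by ring,
        tallMinor_pt_mul_pow a₀ a₁ a₂ a₃ (v 0) (v 2) h02 e g _]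
      ring
    · simp
  rw [Finset.sum_congr rfl fun v _ => hsplit v, Finset.sum_sub_distrib,
    sum_inj_three (fun x => ptRow k a₀ a₁ a₂ a₃ x ^ (e + 1)) (fun y => ptRow k a₀ a₁ a₂ a₃ y ^ f)
      (fun z => if z = xE k 1 then a₁ ^ g else 0),
    sum_inj_three (fun x => if x = xE k 1 then a₁ ^ e else 0) (fun y => ptRow k a₀ a₁ a₂ a₃ y ^ f)
      (fun z => ptRow k a₀ a₁ a₂ a₃ z ^ (g + 1))]
  simp only [mul_ite, ite_mul, mul_zero, zero_mul, sum_ite_xE_one, e1, ← pow_add, ← prs_def]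

/-- **Four classes, minor on classes `0, 1`** (`T2111`), by `sum_inj_four`.
[cite: DuttaGesmundoIkenmeyerJindalLysikovJSC2025, Prop. 4.12] -/
theorem sum_nuf4_01 (e f g h : ℕ) :
    (∑ v : Fin 4 → Fin (2 * k + 5), if Function.Injective v then
        tallMinor k (pt k a₀ a₁ a₂ a₃) (v 0) (v 1) *
          ((pt k a₀ a₁ a₂ a₃) (xE k 0) (v 0) ^ e * (pt k a₀ a₁ a₂ a₃) (xE k 0) (v 1) ^ f *
            (pt k a₀ a₁ a₂ a₃) (xE k 0) (v 2) ^ g * (pt k a₀ a₁ a₂ a₃) (xE k 0) (v 3) ^ h) else 0) =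
      (prs k a₀ a₁ a₂ a₃ (e + 1) * a₁ ^ f * prs k a₀ a₁ a₂ a₃ g * prs k a₀ a₁ a₂ a₃ h
        - a₁ ^ (e + 1) * a₁ ^ f * prs k a₀ a₁ a₂ a₃ g * prs k a₀ a₁ a₂ a₃ h
        - prs k a₀ a₁ a₂ a₃ (e + 1 + g) * a₁ ^ f * prs k a₀ a₁ a₂ a₃ h
        - prs k a₀ a₁ a₂ a₃ (e + 1 + h) * a₁ ^ f * prs k a₀ a₁ a₂ a₃ g
        - a₁ ^ f * a₁ ^ g * prs k a₀ a₁ a₂ a₃ (e + 1) * prs k a₀ a₁ a₂ a₃ h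
        - a₁ ^ f * a₁ ^ h * prs k a₀ a₁ a₂ a₃ (e + 1) * prs k a₀ a₁ a₂ a₃ g
        - prs k a₀ a₁ a₂ a₃ (g + h) * prs k a₀ a₁ a₂ a₃ (e + 1) * a₁ ^ f
        + 2 * (a₁ ^ (e + 1) * a₁ ^ f * a₁ ^ g * prs k a₀ a₁ a₂ a₃ h + a₁ ^ (e + 1) * a₁ ^ f * a₁ ^ h * prs k a₀ a₁ a₂ a₃ g
          + prs k a₀ a₁ a₂ a₃ (e + 1 + g + h) * a₁ ^ f + a₁ ^ f * a₁ ^ g * a₁ ^ h * prs k a₀ a₁ a₂ a₃ (e + 1))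
        + (a₁ ^ (e + 1) * a₁ ^ f * prs k a₀ a₁ a₂ a₃ (g + h) + prs k a₀ a₁ a₂ a₃ (e + 1 + g) * (a₁ ^ f * a₁ ^ h)
          + prs k a₀ a₁ a₂ a₃ (e + 1 + h) * (a₁ ^ f * a₁ ^ g))
        - 6 * (a₁ ^ (e + 1) * a₁ ^ f * a₁ ^ g * a₁ ^ h))
      - (a₁ ^ e * prs k a₀ a₁ a₂ a₃ (f + 1) * prs k a₀ a₁ a₂ a₃ g * prs k a₀ a₁ a₂ a₃ h
        - a₁ ^ e * a₁ ^ (f + 1) * prs k a₀ a₁ a₂ a₃ g * prs k a₀ a₁ a₂ a₃ h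
        - a₁ ^ e * a₁ ^ g * prs k a₀ a₁ a₂ a₃ (f + 1) * prs k a₀ a₁ a₂ a₃ h
        - a₁ ^ e * a₁ ^ h * prs k a₀ a₁ a₂ a₃ (f + 1) * prs k a₀ a₁ a₂ a₃ g
        - prs k a₀ a₁ a₂ a₃ (f + 1 + g) * a₁ ^ e * prs k a₀ a₁ a₂ a₃ h
        - prs k a₀ a₁ a₂ a₃ (f + 1 + h) * a₁ ^ e * prs k a₀ a₁ a₂ a₃ g
        - prs k a₀ a₁ a₂ a₃ (g + h) * a₁ ^ e * prs k a₀ a₁ a₂ a₃ (f + 1)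
        + 2 * (a₁ ^ e * a₁ ^ (f + 1) * a₁ ^ g * prs k a₀ a₁ a₂ a₃ h + a₁ ^ e * a₁ ^ (f + 1) * a₁ ^ h * prs k a₀ a₁ a₂ a₃ g
          + a₁ ^ e * a₁ ^ g * a₁ ^ h * prs k a₀ a₁ a₂ a₃ (f + 1) + prs k a₀ a₁ a₂ a₃ (f + 1 + g + h) * a₁ ^ e)
        + (a₁ ^ e * a₁ ^ (f + 1) * prs k a₀ a₁ a₂ a₃ (g + h) + a₁ ^ e * a₁ ^ g * prs k a₀ a₁ a₂ a₃ (f + 1 + h)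
          + a₁ ^ e * a₁ ^ h * prs k a₀ a₁ a₂ a₃ (f + 1 + g))
        - 6 * (a₁ ^ e * a₁ ^ (f + 1) * a₁ ^ g * a₁ ^ h)) := by
  have e1 := (ptRow_xE (k := k) a₀ a₁ a₂ a₃).2.1
  have hsplit : ∀ v : Fin 4 → Fin (2 * k + 5),
      (if Function.Injective v then tallMinor k (pt k a₀ a₁ a₂ a₃) (v 0) (v 1) *
          ((pt k a₀ a₁ a₂ a₃) (xE k 0) (v 0) ^ e * (pt k a₀ a₁ a₂ a₃) (xE k 0) (v 1) ^ f *
            (pt k a₀ a₁ a₂ a₃) (xE k 0) (v 2) ^ g * (pt k a₀ a₁ a₂ a₃) (xE k 0) (v 3) ^ h) else 0) =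
        (if Function.Injective v then
          (fun x => ptRow k a₀ a₁ a₂ a₃ x ^ (e + 1)) (v 0) *
            (fun y => if y = xE k 1 then a₁ ^ f else 0) (v 1) *
            (fun z => ptRow k a₀ a₁ a₂ a₃ z ^ g) (v 2) *
            (fun t => ptRow k a₀ a₁ a₂ a₃ t ^ h) (v 3) else 0) -
        (if Function.Injective v then
          (fun x => if x = xE k 1 then a₁ ^ e else 0) (v 0) *
            (fun y => ptRow k a₀ a₁ a₂ a₃ y ^ (f + 1)) (v 1) *
            (fun z => ptRow k a₀ a₁ a₂ a₃ z ^ g) (v 2) *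
            (fun t => ptRow k a₀ a₁ a₂ a₃ t ^ h) (v 3) else 0) := by
    intro v
    split_ifs with hv
    · have h01 : v 0 ≠ v 1 := fun hh => absurd (hv hh) (by decide)
      rw [pt_apply_top, pt_apply_top, pt_apply_top, pt_apply_top,
        show ptRow k a₀ a₁ a₂ a₃ (v 0) ^ e * ptRow k a₀ a₁ a₂ a₃ (v 1) ^ f * ptRow k a₀ a₁ a₂ a₃ (v 2) ^ g
            * ptRow k a₀ a₁ a₂ a₃ (v 3) ^ h
          = ptRow k a₀ a₁ a₂ a₃ (v 0) ^ e * ptRow k a₀ a₁ a₂ a₃ (v 1) ^ f *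
            (ptRow k a₀ a₁ a₂ a₃ (v 2) ^ g * ptRow k a₀ a₁ a₂ a₃ (v 3) ^ h) from by ring,
        tallMinor_pt_mul_pow a₀ a₁ a₂ a₃ (v 0) (v 1) h01 e f _]
      ring
    · simp
  rw [Finset.sum_congr rfl fun v _ => hsplit v, Finset.sum_sub_distrib,
    sum_inj_four (fun x => ptRow k a₀ a₁ a₂ a₃ x ^ (e + 1)) (fun y => if y = xE k 1 then a₁ ^ f else 0)
      (fun z => ptRow k a₀ a₁ a₂ a₃ z ^ g) (fun t => ptRow k a₀ a₁ a₂ a₃ t ^ h),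
    sum_inj_four (fun x => if x = xE k 1 then a₁ ^ e else 0) (fun y => ptRow k a₀ a₁ a₂ a₃ y ^ (f + 1))
      (fun z => ptRow k a₀ a₁ a₂ a₃ z ^ g) (fun t => ptRow k a₀ a₁ a₂ a₃ t ^ h)]
  simp only [mul_ite, ite_mul, mul_zero, zero_mul, sum_ite_xE_one, e1, ← pow_add, ← prs_def]

end Shapes

section Tableaux

variable (a₀ a₁ a₂ a₃ : ℂ)

/-- **The ν-part sum of `T41` at a point.** [cite: DuttaGesmundoIkenmeyerJindalLysikovJSC2025, Prop. 4.12] -/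
theorem T41.sum_nuf_pt :
    (∑ v : Fin 2 → Fin (2 * k + 5),
        if Function.Injective v then T41.nuf k (pt k a₀ a₁ a₂ a₃) v else 0) =
      prs k a₀ a₁ a₂ a₃ (8 * k + 15 + 1) * a₁ ^ (2 * k + 3)
        - a₁ ^ (8 * k + 15) * prs k a₀ a₁ a₂ a₃ (2 * k + 3 + 1) := by
  unfold T41.nuf
  exact sum_nuf2 a₀ a₁ a₂ a₃ (8 * k + 15) (2 * k + 3)

/-- **The ν-part sum of `T32` at a point.** [cite: DuttaGesmundoIkenmeyerJindalLysikovJSC2025, Prop. 4.12] -/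
theorem T32.sum_nuf_pt :
    (∑ v : Fin 2 → Fin (2 * k + 5),
        if Function.Injective v then T32.nuf k (pt k a₀ a₁ a₂ a₃) v else 0) =
      prs k a₀ a₁ a₂ a₃ (6 * k + 11 + 1) * a₁ ^ (4 * k + 7)
        - a₁ ^ (6 * k + 11) * prs k a₀ a₁ a₂ a₃ (4 * k + 7 + 1) := by
  unfold T32.nuf
  exact sum_nuf2 a₀ a₁ a₂ a₃ (6 * k + 11) (4 * k + 7)

end Tableaux

section Numeric

/-- `4 ^ n = 2 ^ (2 n)` in `ℂ`. [cite: DuttaGesmundoIkenmeyerJindalLysikovJSC2025, Prop. 4.12] -/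
theorem four_pow_eq (n : ℕ) : (4 : ℂ) ^ n = 2 ^ (2 * n) := by
  rw [pow_mul]; norm_num

/-- `8 ^ n = 2 ^ (3 n)` in `ℂ`. [cite: DuttaGesmundoIkenmeyerJindalLysikovJSC2025, Prop. 4.12] -/
theorem eight_pow_eq (n : ℕ) : (8 : ℂ) ^ n = 2 ^ (3 * n) := by
  rw [pow_mul]; norm_num

/-- Power sums of a two-point row `(1, c, 0, 0)`. [cite: DuttaGesmundoIkenmeyerJindalLysikovJSC2025, Prop. 4.12] -/
theorem prs_two (c : ℂ) {e : ℕ} (he : 1 ≤ e) : prs k 1 c 0 0 e = 1 + c ^ e := by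
  rw [prs_eq 1 c 0 0 he, one_pow, zero_pow (by omega)]; ring

/-- Power sums of a three-point row `(1, c, c', 0)`. [cite: DuttaGesmundoIkenmeyerJindalLysikovJSC2025, Prop. 4.12] -/
theorem prs_three (c c' : ℂ) {e : ℕ} (he : 1 ≤ e) : prs k 1 c c' 0 e = 1 + c ^ e + c' ^ e := by
  rw [prs_eq 1 c c' 0 he, one_pow, zero_pow (by omega)]; ring

/-- Power sums of a four-point row `(1, c, c', c'')`. [cite: DuttaGesmundoIkenmeyerJindalLysikovJSC2025, Prop. 4.12] -/
theorem prs_four (c c' c'' : ℂ) {e : ℕ} (he : 1 ≤ e) :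
    prs k 1 c c' c'' e = 1 + c ^ e + c' ^ e + c'' ^ e := by
  rw [prs_eq 1 c c' c'' he, one_pow]

/-- **`T41` at `A1 = pt 1 2 0 0`.** [cite: DuttaGesmundoIkenmeyerJindalLysikovJSC2025, Prop. 4.12] -/
theorem T41.val_A1 :
    (∑ v : Fin 2 → Fin (2 * k + 5), if Function.Injective v then T41.nuf k (pt k 1 2 0 0) v else 0) =
      (2 : ℂ) ^ (2 * k + 3) - 2 ^ (8 * k + 15) := by
  rw [T41.sum_nuf_pt, prs_two 2 (by omega), prs_two 2 (by omega)]
  ring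

/-- **`T41` at `A2 = pt 1 4 0 0`.** [cite: DuttaGesmundoIkenmeyerJindalLysikovJSC2025, Prop. 4.12] -/
theorem T41.val_A2 :
    (∑ v : Fin 2 → Fin (2 * k + 5), if Function.Injective v then T41.nuf k (pt k 1 4 0 0) v else 0) =
      (2 : ℂ) ^ (4 * k + 6) - 2 ^ (16 * k + 30) := by
  rw [T41.sum_nuf_pt, prs_two 4 (by omega), prs_two 4 (by omega), four_pow_eq, four_pow_eq,
    four_pow_eq, four_pow_eq]
  ring_nf

/-- **`T32` at `A1 = pt 1 2 0 0`.** [cite: DuttaGesmundoIkenmeyerJindalLysikovJSC2025, Prop. 4.12] -/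
theorem T32.val_A1 :
    (∑ v : Fin 2 → Fin (2 * k + 5), if Function.Injective v then T32.nuf k (pt k 1 2 0 0) v else 0) =
      (2 : ℂ) ^ (4 * k + 7) - 2 ^ (6 * k + 11) := by
  rw [T32.sum_nuf_pt, prs_two 2 (by omega), prs_two 2 (by omega)]
  ring

/-- **`T32` at `A2 = pt 1 4 0 0`.** [cite: DuttaGesmundoIkenmeyerJindalLysikovJSC2025, Prop. 4.12] -/
theorem T32.val_A2 :
    (∑ v : Fin 2 → Fin (2 * k + 5), if Function.Injective v then T32.nuf k (pt k 1 4 0 0) v else 0) =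
      (2 : ℂ) ^ (8 * k + 14) - 2 ^ (12 * k + 22) := by
  rw [T32.sum_nuf_pt, prs_two 4 (by omega), prs_two 4 (by omega), four_pow_eq, four_pow_eq,
    four_pow_eq, four_pow_eq]
  ring_nf

/-- **`T311` at `A3 = pt 1 4 2 0`.** [cite: DuttaGesmundoIkenmeyerJindalLysikovJSC2025, Prop. 4.12] -/
theorem T311.val_A3 :
    (∑ v : Fin 3 → Fin (2 * k + 5), if Function.Injective v then T311.nuf k (pt k 1 4 2 0) v else 0) =
      -(2 : ℂ) ^ (14 * k + 27) + 2 ^ (10 * k + 18) + 2 ^ (6 * k + 10) := by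
  unfold T311.nuf
  rw [sum_nuf3_01 1 4 2 0 (6 * k + 11) (2 * k + 3) (2 * k + 4)]
  rw [prs_three 4 2 (show 1 ≤ 6 * k + 11 + 1 by omega), prs_three 4 2 (show 1 ≤ 2 * k + 4 by omega),
    prs_three 4 2 (show 1 ≤ 6 * k + 11 + 1 + (2 * k + 4) by omega),
    prs_three 4 2 (show 1 ≤ 2 * k + 3 + 1 + (2 * k + 4) by omega)]
  simp only [four_pow_eq]
  ring_nf

/-- **`T311` at `A4 = pt 1 2 4 0`.** [cite: DuttaGesmundoIkenmeyerJindalLysikovJSC2025, Prop. 4.12] -/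
theorem T311.val_A4 :
    (∑ v : Fin 3 → Fin (2 * k + 5), if Function.Injective v then T311.nuf k (pt k 1 2 4 0) v else 0) =
      (2 : ℂ) ^ (14 * k + 27) - 2 ^ (10 * k + 20) + 2 ^ (6 * k + 11) := by
  unfold T311.nuf
  rw [sum_nuf3_01 1 2 4 0 (6 * k + 11) (2 * k + 3) (2 * k + 4)]
  rw [prs_three 2 4 (show 1 ≤ 6 * k + 11 + 1 by omega), prs_three 2 4 (show 1 ≤ 2 * k + 4 by omega),
    prs_three 2 4 (show 1 ≤ 6 * k + 11 + 1 + (2 * k + 4) by omega),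
    prs_three 2 4 (show 1 ≤ 2 * k + 3 + 1 + (2 * k + 4) by omega)]
  simp only [four_pow_eq]
  ring_nf

/-- **`T221` at `A3 = pt 1 4 2 0`.** [cite: DuttaGesmundoIkenmeyerJindalLysikovJSC2025, Prop. 4.12] -/
theorem T221.val_A3 :
    (∑ v : Fin 3 → Fin (2 * k + 5), if Function.Injective v then T221.nuf k (pt k 1 4 2 0) v else 0) =
      -(2 : ℂ) ^ (12 * k + 22) - 2 ^ (10 * k + 18) + 2 ^ (8 * k + 15) := by
  unfold T221.nuf
  rw [sum_nuf3_02 1 4 2 0 (4 * k + 7) (4 * k + 8) (2 * k + 3)]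
  rw [prs_three 4 2 (show 1 ≤ 4 * k + 7 + 1 by omega),
    prs_three 4 2 (show 1 ≤ 4 * k + 7 + 1 + (4 * k + 8) by omega),
    prs_three 4 2 (show 1 ≤ 2 * k + 3 + 1 by omega),
    prs_three 4 2 (show 1 ≤ 4 * k + 8 + (2 * k + 3 + 1) by omega)]
  simp only [four_pow_eq]
  ring_nf

/-- **`T221` at `A4 = pt 1 2 4 0`.** [cite: DuttaGesmundoIkenmeyerJindalLysikovJSC2025, Prop. 4.12] -/
theorem T221.val_A4 :
    (∑ v : Fin 3 → Fin (2 * k + 5), if Function.Injective v then T221.nuf k (pt k 1 2 4 0) v else 0) =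
      -(2 : ℂ) ^ (12 * k + 23) + 2 ^ (10 * k + 20) - 2 ^ (8 * k + 15) := by
  unfold T221.nuf
  rw [sum_nuf3_02 1 2 4 0 (4 * k + 7) (4 * k + 8) (2 * k + 3)]
  rw [prs_three 2 4 (show 1 ≤ 4 * k + 7 + 1 by omega),
    prs_three 2 4 (show 1 ≤ 4 * k + 7 + 1 + (4 * k + 8) by omega),
    prs_three 2 4 (show 1 ≤ 2 * k + 3 + 1 by omega),
    prs_three 2 4 (show 1 ≤ 4 * k + 8 + (2 * k + 3 + 1) by omega)]
  simp only [four_pow_eq]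
  ring_nf

/-- **`T2111` at `A5 = pt 1 8 2 4`.** [cite: DuttaGesmundoIkenmeyerJindalLysikovJSC2025, Prop. 4.12] -/
theorem T2111.val_A5 :
    (∑ v : Fin 4 → Fin (2 * k + 5), if Function.Injective v then T2111.nuf k (pt k 1 8 2 4) v else 0) =
      -(3 : ℂ) * 2 ^ (18 * k + 34) + 2 ^ (16 * k + 30) + 2 ^ (14 * k + 26) + 2 ^ (12 * k + 22) := by
  unfold T2111.nuf
  rw [sum_nuf4_01 1 8 2 4 (4 * k + 7) (2 * k + 3) (2 * k + 4) (2 * k + 4)]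
  rw [prs_four 8 2 4 (show 1 ≤ 4 * k + 7 + 1 by omega), prs_four 8 2 4 (show 1 ≤ 2 * k + 4 by omega),
    prs_four 8 2 4 (show 1 ≤ 4 * k + 7 + 1 + (2 * k + 4) by omega),
    prs_four 8 2 4 (show 1 ≤ 2 * k + 4 + (2 * k + 4) by omega),
    prs_four 8 2 4 (show 1 ≤ 4 * k + 7 + 1 + (2 * k + 4) + (2 * k + 4) by omega),
    prs_four 8 2 4 (show 1 ≤ 2 * k + 3 + 1 + (2 * k + 4) + (2 * k + 4) by omega)]
  simp only [four_pow_eq, eight_pow_eq]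
  ring_nf

/-- **`T2111` vanishes at `A1 = pt 1 2 0 0`** (fewer support points than classes). [cite: DuttaGesmundoIkenmeyerJindalLysikovJSC2025, Prop. 4.12] -/
theorem T2111.val_A1 :
    (∑ v : Fin 4 → Fin (2 * k + 5), if Function.Injective v then T2111.nuf k (pt k 1 2 0 0) v else 0) = 0 := by
  unfold T2111.nuf
  rw [sum_nuf4_01 1 2 0 0 (4 * k + 7) (2 * k + 3) (2 * k + 4) (2 * k + 4)]
  rw [prs_two 2 (show 1 ≤ 4 * k + 7 + 1 by omega), prs_two 2 (show 1 ≤ 2 * k + 4 by omega),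
    prs_two 2 (show 1 ≤ 4 * k + 7 + 1 + (2 * k + 4) by omega),
    prs_two 2 (show 1 ≤ 2 * k + 4 + (2 * k + 4) by omega),
    prs_two 2 (show 1 ≤ 4 * k + 7 + 1 + (2 * k + 4) + (2 * k + 4) by omega),
    prs_two 2 (show 1 ≤ 2 * k + 3 + 1 + (2 * k + 4) + (2 * k + 4) by omega)]
  ring

/-- **`T2111` vanishes at `A2 = pt 1 4 0 0`** (fewer support points than classes). [cite: DuttaGesmundoIkenmeyerJindalLysikovJSC2025, Prop. 4.12] -/
theorem T2111.val_A2 :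
    (∑ v : Fin 4 → Fin (2 * k + 5), if Function.Injective v then T2111.nuf k (pt k 1 4 0 0) v else 0) = 0 := by
  unfold T2111.nuf
  rw [sum_nuf4_01 1 4 0 0 (4 * k + 7) (2 * k + 3) (2 * k + 4) (2 * k + 4)]
  rw [prs_two 4 (show 1 ≤ 4 * k + 7 + 1 by omega), prs_two 4 (show 1 ≤ 2 * k + 4 by omega),
    prs_two 4 (show 1 ≤ 4 * k + 7 + 1 + (2 * k + 4) by omega),
    prs_two 4 (show 1 ≤ 2 * k + 4 + (2 * k + 4) by omega),
    prs_two 4 (show 1 ≤ 4 * k + 7 + 1 + (2 * k + 4) + (2 * k + 4) by omega),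
    prs_two 4 (show 1 ≤ 2 * k + 3 + 1 + (2 * k + 4) + (2 * k + 4) by omega)]
  ring

/-- **`T2111` vanishes at `A3 = pt 1 4 2 0`** (fewer support points than classes). [cite: DuttaGesmundoIkenmeyerJindalLysikovJSC2025, Prop. 4.12] -/
theorem T2111.val_A3 :
    (∑ v : Fin 4 → Fin (2 * k + 5), if Function.Injective v then T2111.nuf k (pt k 1 4 2 0) v else 0) = 0 := by
  unfold T2111.nuf
  rw [sum_nuf4_01 1 4 2 0 (4 * k + 7) (2 * k + 3) (2 * k + 4) (2 * k + 4)]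
  rw [prs_three 4 2 (show 1 ≤ 4 * k + 7 + 1 by omega), prs_three 4 2 (show 1 ≤ 2 * k + 4 by omega),
    prs_three 4 2 (show 1 ≤ 4 * k + 7 + 1 + (2 * k + 4) by omega),
    prs_three 4 2 (show 1 ≤ 2 * k + 4 + (2 * k + 4) by omega),
    prs_three 4 2 (show 1 ≤ 4 * k + 7 + 1 + (2 * k + 4) + (2 * k + 4) by omega),
    prs_three 4 2 (show 1 ≤ 2 * k + 3 + 1 + (2 * k + 4) + (2 * k + 4) by omega)]
  ring

/-- **`T2111` vanishes at `A4 = pt 1 2 4 0`** (fewer support points than classes). [cite: DuttaGesmundoIkenmeyerJindalLysikovJSC2025, Prop. 4.12] -/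
theorem T2111.val_A4 :
    (∑ v : Fin 4 → Fin (2 * k + 5), if Function.Injective v then T2111.nuf k (pt k 1 2 4 0) v else 0) = 0 := by
  unfold T2111.nuf
  rw [sum_nuf4_01 1 2 4 0 (4 * k + 7) (2 * k + 3) (2 * k + 4) (2 * k + 4)]
  rw [prs_three 2 4 (show 1 ≤ 4 * k + 7 + 1 by omega), prs_three 2 4 (show 1 ≤ 2 * k + 4 by omega),
    prs_three 2 4 (show 1 ≤ 4 * k + 7 + 1 + (2 * k + 4) by omega),
    prs_three 2 4 (show 1 ≤ 2 * k + 4 + (2 * k + 4) by omega),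
    prs_three 2 4 (show 1 ≤ 4 * k + 7 + 1 + (2 * k + 4) + (2 * k + 4) by omega),
    prs_three 2 4 (show 1 ≤ 2 * k + 3 + 1 + (2 * k + 4) + (2 * k + 4) by omega)]
  ring

/-- **`T311` vanishes at `A1 = pt 1 2 0 0`** (two support points, three classes). [cite: DuttaGesmundoIkenmeyerJindalLysikovJSC2025, Prop. 4.12] -/
theorem T311.val_A1 :
    (∑ v : Fin 3 → Fin (2 * k + 5), if Function.Injective v then T311.nuf k (pt k 1 2 0 0) v else 0) = 0 := by
  unfold T311.nuf
  rw [sum_nuf3_01 1 2 0 0 (6 * k + 11) (2 * k + 3) (2 * k + 4)]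
  rw [prs_two 2 (show 1 ≤ 6 * k + 11 + 1 by omega), prs_two 2 (show 1 ≤ 2 * k + 4 by omega), prs_two 2 (show 1 ≤ 6 * k + 11 + 1 + (2 * k + 4) by omega), prs_two 2 (show 1 ≤ 2 * k + 3 + 1 + (2 * k + 4) by omega)]
  ring

/-- **`T311` vanishes at `A2 = pt 1 4 0 0`** (two support points, three classes). [cite: DuttaGesmundoIkenmeyerJindalLysikovJSC2025, Prop. 4.12] -/
theorem T311.val_A2 :
    (∑ v : Fin 3 → Fin (2 * k + 5), if Function.Injective v then T311.nuf k (pt k 1 4 0 0) v else 0) = 0 := by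
  unfold T311.nuf
  rw [sum_nuf3_01 1 4 0 0 (6 * k + 11) (2 * k + 3) (2 * k + 4)]
  rw [prs_two 4 (show 1 ≤ 6 * k + 11 + 1 by omega), prs_two 4 (show 1 ≤ 2 * k + 4 by omega), prs_two 4 (show 1 ≤ 6 * k + 11 + 1 + (2 * k + 4) by omega), prs_two 4 (show 1 ≤ 2 * k + 3 + 1 + (2 * k + 4) by omega)]
  ring

/-- **`T221` vanishes at `A1 = pt 1 2 0 0`** (two support points, three classes). [cite: DuttaGesmundoIkenmeyerJindalLysikovJSC2025, Prop. 4.12] -/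
theorem T221.val_A1 :
    (∑ v : Fin 3 → Fin (2 * k + 5), if Function.Injective v then T221.nuf k (pt k 1 2 0 0) v else 0) = 0 := by
  unfold T221.nuf
  rw [sum_nuf3_02 1 2 0 0 (4 * k + 7) (4 * k + 8) (2 * k + 3)]
  rw [prs_two 2 (show 1 ≤ 4 * k + 7 + 1 by omega), prs_two 2 (show 1 ≤ 4 * k + 7 + 1 + (4 * k + 8) by omega), prs_two 2 (show 1 ≤ 2 * k + 3 + 1 by omega), prs_two 2 (show 1 ≤ 4 * k + 8 + (2 * k + 3 + 1) by omega)]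
  ring

/-- **`T221` vanishes at `A2 = pt 1 4 0 0`** (two support points, three classes). [cite: DuttaGesmundoIkenmeyerJindalLysikovJSC2025, Prop. 4.12] -/
theorem T221.val_A2 :
    (∑ v : Fin 3 → Fin (2 * k + 5), if Function.Injective v then T221.nuf k (pt k 1 4 0 0) v else 0) = 0 := by
  unfold T221.nuf
  rw [sum_nuf3_02 1 4 0 0 (4 * k + 7) (4 * k + 8) (2 * k + 3)]
  rw [prs_two 4 (show 1 ≤ 4 * k + 7 + 1 by omega), prs_two 4 (show 1 ≤ 4 * k + 7 + 1 + (4 * k + 8) by omega), prs_two 4 (show 1 ≤ 2 * k + 3 + 1 by omega), prs_two 4 (show 1 ≤ 4 * k + 8 + (2 * k + 3 + 1) by omega)]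
  ring

end Numeric

end DGIJLLift

end Literature.Computability.AlgebraicComplexity

end
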